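import Summits.FinalStateConjecture.FinalStateConjecture.Theorems.SwallowTheDatumKerrShieldedSettlesStubExteriorTransportAuxLift
import Summits.FinalStateConjecture.FinalStateConjecture.Theorems.SwallowTheDatumKerrShieldedSettlesStubExteriorTransportAuxPush
import Summits.FinalStateConjecture.FinalStateConjecture.Statement
import HarnessLib

/-!
# `KerrShieldedSettles`, line `tapered-temporal-collar` — stub S7 `stub_exteriorTransport` (clauses (b)+(c):
# the final-state decomposition of every vacuum development containing the tapered collar)

Crux `stmt-FinalStateConjecture-10054`
(`Summit.FinalStateConjecture.FinalStateConjecture.Theses.SwallowTheDatum.KerrShieldedSettles`), registered stub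
`stub_exteriorTransport`.  For a shielded datum, ANY vacuum Cauchy development `𝒟` of `D`, a chart map
`χ : Kerr.region a r₁ → 𝒟` which on the tapered collar `W = {0 < x⁰ − T(r) + (r − r₁)/4}` (`T = bentHeight M a`) is
smooth, an open embedding, isometric and oriented, with `χ ∘ ψ = ι ∘ φ` on the bent leaf `ψ = graph T`, and a
Kerr-side `C²` final-state decomposition `dec` of `O_K = {r > r₊, x⁰ ≥ T(r)}` with sub-extremal holes, exhaustive
charts, all chart values in `O_K`, `O_K ⊆ J⁺_K(leaf)` and `O_K ⊆ I⁻_K(dec.charted)`: `𝒟` carries the pushed-forward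
decomposition `d` of `O := χ(O_K)` (part 3, `ExteriorTransport.exists_decomposition_image`), and
**`O = J⁺(ιX) ∩ I⁻(d.charted)`**: `⊆` by pushing the two Kerr-side inclusions through `χ` (part 1; the leaf is mapped
into `ιX` because `χ ∘ ψ = ι ∘ φ`), `⊇` by the last-exit argument (part 2, `ExteriorTransport.mem_image_of_lastExit`,
with the Cauchy hypersurface `ιX` of `𝒟`).

References: M. Dafermos, J. Luk, arXiv:1710.01722, Conjecture 1; B. O'Neill, *Semi-Riemannian geometry* (1983),
Ch. 14, Cor. 14.1, Lemma 14.29; M. Dafermos, I. Rodnianski, arXiv:0811.0354, §5.1.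
-/

set_option linter.dupNamespace false

noncomputable section

open Set Filter Function
open scoped Manifold ContDiff Topology
open Literature.Geometry.Lorentzian
open Summit.FinalStateConjecture.FinalStateConjecture.Theorems.KerrShieldedDataExist.Negative
  (bentHeight graph psi_eq_graph mass_pos)

namespace Summit.FinalStateConjecture.FinalStateConjecture.Theorems.SwallowTheDatum.KerrShieldedSettles

open ExteriorTransport CollarEmbedsMGHD in
set_option linter.unusedVariables false in
/-- **S7 `stub_exteriorTransport` — the decomposition region of `𝒟` is the image of `O_K`; push the charts**
(clauses (b)+(c) of crux `KerrShieldedSettles`, line `tapered-temporal-collar`).  For a shielded datum (sub-extremal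
`(M, a)`, `r₋ < r₁ < r₊`, `ψ` the graph of `T = bentHeight M a`), ANY vacuum Cauchy development `𝒟` of `D`, a chart map
`χ` smooth / open embedding / isometric / oriented on the tapered collar `W` with `χ ∘ ψ = ι ∘ φ`, and a Kerr-side
`C²` final-state decomposition `dec` of `O_K = {r > r₊, x⁰ ≥ T(r)}` with sub-extremal holes, exhaustive charts, chart
values in `O_K`, `O_K ⊆ J⁺_K(leaf)`, `O_K ⊆ I⁻_K(dec.charted)`: there is a `C²` final-state decomposition `d` of
`O := χ(O_K)` in `𝒟` with sub-extremal holes, `O = exteriorOf 𝒟 d.charted` and `HasExhaustiveCharts d`.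
Proof: `d` is the push-forward of `dec` (charts `χ ∘ dec.chart i`, `χ ∘ dec.flatChart`; same deviation numbers by the
isometry on `W`, covering clauses pushed through `χ` along causal curves that stay in `{u ≥ 0} ⊆ W`,
`ExteriorTransport.exists_decomposition_image`); `χ(O_K) ⊆ J⁺(ιX) ∩ I⁻(χ(dec.charted))` by pushing the two Kerr-side
inclusions (`image_causalFuture_subset_of_le`, `mem_chronologicalPast_image_of_le`; leaf points are `ψ y`, mapped to
`ι(φ y) ∈ ιX`), and `⊇` is the LAST-EXIT ARGUMENT `ExteriorTransport.mem_image_of_lastExit` (Disproof.lean §C1) run in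
`𝒟` with its Cauchy hypersurface `ιX` (achronal, `IsCauchyHypersurface.isAchronal_holds`; push-up
`CausalityPushUp`; horizon barrier and escape analysis in the chart).  Dafermos–Luk arXiv:1710.01722, Conjecture 1;
O'Neill 1983, Ch. 14, Cor. 14.1 and Lemma 14.29. [cite: DafermosLuk2017, Conjecture 1] -/
theorem stub_exteriorTransport : ∀ [Kerr.Facts] (X : Type) [TopologicalSpace X]
    [ChartedSpace E3 X] [IsManifold (𝓡 3) ((⊤ : ℕ∞) : WithTop ℕ∞) X] [T2Space X]
    [SecondCountableTopology X] [ConnectedSpace X] (D : InitialDataSet (𝓡 3) X)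
    (M a r₁ : ℝ) (hM : 0 ≤ M) (φ : Kerr.slice a r₁ → X)
    (ψ : Kerr.slice a r₁ → Kerr.region a r₁),
    |a| < M → Kerr.rMinus M a < r₁ → r₁ < Kerr.rPlus M a →
    (∀ y : Kerr.slice a r₁, (ψ y : E4) =
        E4.ofTimeSpace (bentHeight M a (Kerr.radius a (E4.ofTimeSpace 0 (y : E3)))) (y : E3)) →
    ∀ (𝒟 : VacuumCauchyDevelopment D) (χ : Kerr.region a r₁ → 𝒟.carrier),
      ContMDiffOn 𝓘(ℝ, E4) (𝓡 4) ((⊤ : ℕ∞) : WithTop ℕ∞) χ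
          {x | 0 < (x : E4) 0 - bentHeight M a (Kerr.radius a (x : E4)) +
            (Kerr.radius a (x : E4) - r₁) / 4} →
      Topology.IsOpenEmbedding (Set.restrict {x : Kerr.region a r₁ |
          0 < (x : E4) 0 - bentHeight M a (Kerr.radius a (x : E4)) +
            (Kerr.radius a (x : E4) - r₁) / 4} χ) →
      (∀ x : Kerr.region a r₁, 0 < (x : E4) 0 - bentHeight M a (Kerr.radius a (x : E4)) +
            (Kerr.radius a (x : E4) - r₁) / 4 →
          (∀ v w : E4, 𝒟.metric.val (χ x) (mfderiv 𝓘(ℝ, E4) (𝓡 4) χ x v)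
              (mfderiv 𝓘(ℝ, E4) (𝓡 4) χ x w) = Kerr.bilin M a (x : E4) v w) ∧
          𝒟.metric.val (χ x) (𝒟.timeOrientation.vectorField (χ x))
              (mfderiv 𝓘(ℝ, E4) (𝓡 4) χ x (Kerr.timeVector M a (x : E4))) < 0) →
      (∀ y : Kerr.slice a r₁, χ (ψ y) = 𝒟.embed (φ y)) →
      ∀ dec : FinalStateDecomposition (Kerr.spacetime M a r₁ hM)
          {x : Kerr.region a r₁ | Kerr.rPlus M a < Kerr.radius a (x : E4) ∧
            bentHeight M a (Kerr.radius a (x : E4)) ≤ (x : E4) 0} 2,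
        (∀ i, Kerr.IsSubextremal (dec.mass i) (dec.spin i)) →
        Summit.FinalStateConjecture.HasExhaustiveCharts dec →
        {x : Kerr.region a r₁ | Kerr.rPlus M a < Kerr.radius a (x : E4) ∧
            bentHeight M a (Kerr.radius a (x : E4)) ≤ (x : E4) 0} ⊆
          (Kerr.smoothMetric M a r₁).causalFuture ((Kerr.timeOrientation M a r₁ hM).ofLE le_top)
            {x : Kerr.region a r₁ | (x : E4) 0 = bentHeight M a (Kerr.radius a (x : E4))} →
        {x : Kerr.region a r₁ | Kerr.rPlus M a < Kerr.radius a (x : E4) ∧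
            bentHeight M a (Kerr.radius a (x : E4)) ≤ (x : E4) 0} ⊆
          (Kerr.smoothMetric M a r₁).chronologicalPast ((Kerr.timeOrientation M a r₁ hM).ofLE le_top)
            dec.charted →
        (∀ i x, dec.chart i x ∈ {x : Kerr.region a r₁ | Kerr.rPlus M a < Kerr.radius a (x : E4) ∧
            bentHeight M a (Kerr.radius a (x : E4)) ≤ (x : E4) 0}) →
        (∀ x, dec.flatChart x ∈ {x : Kerr.region a r₁ | Kerr.rPlus M a < Kerr.radius a (x : E4) ∧
            bentHeight M a (Kerr.radius a (x : E4)) ≤ (x : E4) 0}) →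
        ∃ (O : Set 𝒟.carrier) (d : FinalStateDecomposition 𝒟.toSpacetime O 2),
          (∀ i, Kerr.IsSubextremal (d.mass i) (d.spin i)) ∧
          O = Summit.FinalStateConjecture.exteriorOf 𝒟.toCauchyDevelopment d.charted ∧
          Summit.FinalStateConjecture.HasExhaustiveCharts d := by
  intro _ X _ _ _ _ _ _ D M a r₁ hM φ ψ ha hr₁ hr₂ hψ 𝒟 χ hχs hχe hχg hχψ dec hsub hex hJ hI hin hin₀
  have hM0 : 0 < M := mass_pos ha
  obtain rfl : ψ = graph M a r₁ := psi_eq_graph rfl hψ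
  -- the pushed-forward decomposition of `χ(O_K)`
  obtain ⟨d, hdsub, hcharted, hdex⟩ := exists_decomposition_image (𝓢 := 𝒟.toSpacetime) (χ := χ) hM0 ha hr₂
    hχs hχe hχg dec hsub hex hin hin₀
  refine ⟨_, d, hdsub, ?_, hdex⟩
  -- leaf points of the chart are mapped into the Cauchy hypersurface `ιX`
  have hleaf : ∀ x : Kerr.region a r₁, (x : E4) 0 = bentHeight M a (Kerr.radius a (x : E4)) →
      χ x ∈ range 𝒟.embed := by
    intro x hx
    obtain ⟨y, rfl⟩ := exists_graph_eq_iff.2 hx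
    exact ⟨φ y, (hχψ y).symm⟩
  rw [hcharted, Summit.FinalStateConjecture.exteriorOf]
  refine Subset.antisymm ?_ ?_
  · -- `χ(O_K) ⊆ J⁺(ιX) ∩ I⁻(χ(charted))`: push the two Kerr-side inclusions through `χ`
    rintro _ ⟨x, hxO, rfl⟩
    refine ⟨?_, mem_chronologicalPast_image_of_le hM0 hM ha hχs hχg hxO.2 (hI hxO)⟩
    have h2 := image_causalFuture_subset_of_le hM0 hM ha hχs hχg
      (S := {x : Kerr.region a r₁ | (x : E4) 0 = bentHeight M a (Kerr.radius a (x : E4))})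
      (fun z hz ↦ le_of_eq (Eq.symm hz)) (mem_image_of_mem χ (hJ hxO))
    refine LorentzianMetric.causalFuture_mono ?_ h2
    rintro _ ⟨z, hz, rfl⟩
    exact hleaf z hz
  · -- `J⁺(ιX) ∩ I⁻(χ(charted)) ⊆ χ(O_K)`: the last-exit argument
    rintro q ⟨hqJ, hqI⟩
    rw [LorentzianMetric.chronologicalPast, LorentzianMetric.chronologicalFuture_eq_biUnion] at hqI
    simp only [mem_iUnion, exists_prop] at hqI
    obtain ⟨p, ⟨c, hc, rfl⟩, hqc⟩ := hqI
    exact mem_image_of_lastExit hM ha hr₁ hr₂ hχs hχe hχg 𝒟.isCauchyHypersurface hleaf (dec.charted_subset hc)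
      hqJ hqc

end Summit.FinalStateConjecture.FinalStateConjecture.Theorems.SwallowTheDatum.KerrShieldedSettles

end
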